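import Summits.HodgeConjecture.CorCM.QuarticCMTypeSlice
import Summits.HodgeConjecture.CorCM.QuarticCMTypePairDichotomy
import HarnessLib

/-!
# The QUARTIC slice of `HC_CM`, IV: biquadratic fields — the slice for EVERY quartic CM field, no hypothesis

COR-CM (cell `pub-hodgecm2`), seat b24, count-neutral lane QUARTIC-SLICE, part IV (sequel of `CorCM/QuarticCMTypeSlice.lean`,
with the pairing `CorCM/QuarticCMTypePairDichotomy.lean`).  Everything is PROVED; theorems only; no definition; no named fact.

A biquadratic CM field `K` (Galois with Klein group `{1, c, g, gc}`) has its four CM types induced from its two imaginary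
quadratic subfields: `Φ₀ = {a, a ∘ g}` is stable under `g`, `Ψ₀ = {a, \overline{a ∘ g}} = {a, a ∘ gc}` under `gc`;
neither is primitive (the chosen realisations are isogenous to squares of CM elliptic curves) and the pair family
`(Φ₀, Ψ₀)` is degenerate in the bookkeeping of `Pohlmann1968.IsNondegenerateFamily`, but every `τ ∈ Aut(ℂ)` preserves
or complements each of them, which is what the pairing file needs.

* §2 `dichotomy_of_forall_smul_mem_iff` (a quartic type `{a, b}` none of whose translates separates `a` from `b` is
  preserved or complemented by every `τ`), `mul_self_eq_one_of_not_isCyclic` (a non-cyclic `Gal(K/ℚ)` of order `4` has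
  exponent `2`), `forall_smul_mem_iff_of_mul_self_eq_one` (`{a, a ∘ h}`, `h² = 1`, is never separated),
  **`hodgeConjectureFor_cmProdAV_of_isGalois_of_not_isCyclic`** — HC for every `∏_j A_{(K,Θ_j)}` over a biquadratic `K`
  (pairing for the reference pair `(Θ 0, (Θ 0)^{(b)})`, then `hodgeConjectureFor_cmProdAV_of_pair`).
* §3 **THE QUARTIC SLICE, NO HYPOTHESIS**: **`hodgeConjectureFor_cmProdAV_quartic`**,
  `hodgeConjectureFor_of_avDominatedBy_cmProdAV_quartic`, **`hodgeConjectureFor_of_isOfCMType_of_endAlgebra_quartic`**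
  (every complex abelian variety of CM type all of whose simple abelian subvarieties have `End⁰ →+* K`, `K` ANY quartic CM
  field — products, powers and isogeny factors of CM abelian surfaces and CM elliptic curves with CM inside one quartic
  CM field — satisfies the Hodge conjecture), **`cmAbelianHodge_slice_quartic`** (the binders of
  `Theses.RankFourFaces.CMAbelianHodge` verbatim).  Print counterpart: Moonen–Zarhin 1999 (simple CM abelian surfaces),
  Imai / Murty (products of CM elliptic curves, Gordon §3), Hazama–Murty (Gordon 7.5) — a known case of the Hodge
  conjecture, here a kernel theorem in `HC_CM`'s binder language with no displayed input.

## References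
* [Gordon1999HodgeAVSurvey] B. B. Gordon, *A survey of the Hodge conjecture for abelian varieties*, §3 Theorem (Imai,
  Murty), 7.5, §9.2, 10.10.
* [MoonenZarhin1999LowDim] B. Moonen, Yu. Zarhin, Math. Ann. 315 (1999) 711–733, section "Hodge groups of simple
  abelian surfaces of CM-type".
* [Shimura1998] G. Shimura, *Abelian Varieties with Complex Multiplication and Modular Functions*, §8.2 Prop. 26.
* [MumfordAV1970] D. Mumford, *Abelian Varieties*, §19.
-/

noncomputable section

open CategoryTheory CategoryTheory.Limits NumberField NumberField.ComplexEmbedding AlgebraicGeometry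
open Literature.AlgebraicGeometry Literature.AlgebraicGeometry.Motives Literature.AlgebraicGeometry.HodgeTheory
open Literature.AlgebraicGeometry.ComplexMultiplication Literature.AlgebraicGeometry.Milne1999
open Literature.AlgebraicGeometry.Pohlmann1968
open Literature.NumberTheory.ComplexMultiplication
open Literature.NumberTheory.ComplexMultiplication.CMTypeOps (bar mem_bar_iff conjugate_mem_iff_notMem
  mem_iff_conjugate_notMem)
open Literature.NumberTheory.Automorphic.PicardCM (cmRealisation CMAbelianVarietyRealised)
open Summit.HodgeConjecture.CorCM.Domination
open Summit.HodgeConjecture.CorCM.CyclicSextic (conjugate_eq_comp_conjGal orderOf_conjGal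
  exists_avDominatedBy_cmProdAV_of_isOfCMType_of_endAlgebra)

namespace Summit.HodgeConjecture.CorCM.QuarticCM

variable {K : Type} [Field K] [NumberField K] [IsCMField K]

/-! ## §2 Biquadratic quartic CM fields -/

/-- **Dichotomy from non-separation.**  For a quartic CM field and `Φ = {a, b}`: if no translate of `Φ` separates `a`
from `b` (`τa ∈ Φ ↔ τb ∈ Φ` for all `τ`, i.e. `Φ` is NOT primitive), then every `τ ∈ Aut(ℂ)` preserves or complements `Φ`.
[cite: Shimura1998, §8.2 Prop. 26] -/
theorem dichotomy_of_forall_smul_mem_iff (h4 : Module.finrank ℚ K = 4) {a b : K →+* ℂ} (hba : b ≠ a)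
    (hba' : b ≠ conjugate a) {Φ : CMType K} (hΦ : ∀ s, s ∈ Φ.1 ↔ s = a ∨ s = b)
    (hnp : ∀ τ : ℂ ≃+* ℂ, τ • a ∈ Φ.1 ↔ τ • b ∈ Φ.1) (τ : ℂ ≃+* ℂ) :
    (∀ s : K →+* ℂ, τ • s ∈ Φ.1 ↔ s ∈ Φ.1) ∨ (∀ s : K →+* ℂ, τ • s ∈ Φ.1 ↔ s ∉ Φ.1) := by
  have ha : a ∈ Φ.1 := (hΦ a).2 (Or.inl rfl)
  have hb : b ∈ Φ.1 := (hΦ b).2 (Or.inr rfl)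
  have hna : conjugate a ∉ Φ.1 := (mem_iff_conjugate_notMem Φ a).1 ha
  have hnb : conjugate b ∉ Φ.1 := (mem_iff_conjugate_notMem Φ b).1 hb
  by_cases hτa : τ • a ∈ Φ.1
  · have hτb : τ • b ∈ Φ.1 := (hnp τ).1 hτa
    refine Or.inl fun s => ?_
    rcases eq_or_eq_or_eq_or_eq h4 hba hba' s with h | h | h | h <;> rw [h]
    · exact iff_of_true hτa ha
    · rw [smul_conjugate]; exact iff_of_false ((mem_iff_conjugate_notMem Φ _).1 hτa) hna
    · exact iff_of_true hτb hb
    · rw [smul_conjugate]; exact iff_of_false ((mem_iff_conjugate_notMem Φ _).1 hτb) hnb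
  · have hτb : τ • b ∉ Φ.1 := fun h => hτa ((hnp τ).2 h)
    refine Or.inr fun s => ?_
    rcases eq_or_eq_or_eq_or_eq h4 hba hba' s with h | h | h | h <;> rw [h]
    · exact iff_of_false hτa (not_not.2 ha)
    · rw [smul_conjugate]; exact iff_of_true ((conjugate_mem_iff_notMem Φ _).2 hτa) hna
    · exact iff_of_false hτb (not_not.2 hb)
    · rw [smul_conjugate]; exact iff_of_true ((conjugate_mem_iff_notMem Φ _).2 hτb) hnb

omit [IsCMField K] in
/-- **A non-cyclic `Gal(K/ℚ)` of order `4` has exponent `2`**: `g² = 1` for every `g` (an element of order `4` would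
generate). [folklore] -/
theorem mul_self_eq_one_of_not_isCyclic [IsGalois ℚ K] (h4 : Module.finrank ℚ K = 4) (hK : ¬IsCyclic (K ≃ₐ[ℚ] K))
    (g : K ≃ₐ[ℚ] K) : g * g = 1 := by
  classical
  have hcard : Fintype.card (K ≃ₐ[ℚ] K) = 4 := by rw [← Nat.card_eq_fintype_card, IsGalois.card_aut_eq_finrank, h4]
  have hdvd : orderOf g ∣ 2 ^ 2 := by rw [show (2 : ℕ) ^ 2 = 4 by norm_num, ← hcard]; exact orderOf_dvd_card
  obtain ⟨k, hk, hk'⟩ := (Nat.dvd_prime_pow Nat.prime_two).1 hdvd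
  interval_cases k
  · rw [pow_zero, orderOf_eq_one_iff] at hk'; rw [hk', mul_one]
  · rw [pow_one] at hk'; rw [← pow_two, ← hk', pow_orderOf_eq_one]
  · exact absurd (isCyclic_of_orderOf_eq_card g (by rw [hk', Nat.card_eq_fintype_card, hcard]; norm_num)) hK

omit [IsCMField K] in
/-- Membership of a twist `a ∘ w` in `{a, a ∘ h}`: `a ∘ w ∈ Φ ↔ w ∈ {1, h}`. [folklore] -/
theorem comp_mem_iff_of_pair {a : K →+* ℂ} {h : K ≃ₐ[ℚ] K} {Φ : CMType K}
    (hΦ : ∀ s, s ∈ Φ.1 ↔ s = a ∨ s = a.comp h.toRingEquiv.toRingHom) (w : K ≃ₐ[ℚ] K) :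
    a.comp w.toRingEquiv.toRingHom ∈ Φ.1 ↔ w = 1 ∨ w = h := by
  rw [hΦ]
  have h1 : a.comp w.toRingEquiv.toRingHom = a ↔ w = 1 :=
    ⟨fun e => comp_algEquiv_injective a (e.trans (RingHom.ext fun _ => rfl)), fun e => by rw [e]; rfl⟩
  rw [h1, (comp_algEquiv_injective a).eq_iff]

omit [IsCMField K] in
/-- **In exponent `2`, no translate of `{a, a ∘ h}` separates `a` from `a ∘ h`** (`τa = a ∘ w ∈ Φ ↔ w ∈ {1,h} ↔
wh ∈ {1, h} ↔ τ(a ∘ h) ∈ Φ`, as `h² = 1`): the type is induced from the fixed field of `h`. [cite: Shimura1998, §8.2 Prop. 26] -/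
theorem forall_smul_mem_iff_of_mul_self_eq_one [IsGalois ℚ K] {a : K →+* ℂ} {h : K ≃ₐ[ℚ] K} (hh : h * h = 1)
    {Φ : CMType K} (hΦ : ∀ s, s ∈ Φ.1 ↔ s = a ∨ s = a.comp h.toRingEquiv.toRingHom) (τ : ℂ ≃+* ℂ) :
    τ • a ∈ Φ.1 ↔ τ • a.comp h.toRingEquiv.toRingHom ∈ Φ.1 := by
  obtain ⟨w, hw⟩ := exists_eq_comp_algEquiv a (τ • a)
  rw [smul_comp_algEquiv, hw, comp_algEquiv_comp, comp_mem_iff_of_pair hΦ, comp_mem_iff_of_pair hΦ]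
  have e1 : w * h = 1 ↔ w = h := by
    rw [mul_eq_one_iff_eq_inv, inv_eq_of_mul_eq_one_right hh]
  have e2 : w * h = h ↔ w = 1 :=
    ⟨fun e => mul_right_cancel (e.trans (one_mul h).symm), fun e => by rw [e, one_mul]⟩
  rw [e1, e2, or_comm]

/-- **HC for `∏_j A_{(K,Θ_j)}` over a BIQUADRATIC quartic CM field `K`** (Galois, non-cyclic group), every finite family
`Θ`, every realisation record `h₃`, unconditionally.  With `Θ 0 = {a, b}`, `b = a ∘ g`, `Ψ = {a, b̄} = {a, a ∘ gc}` and
`g² = (gc)² = 1`: every `τ` preserves or complements `Θ 0` and `Ψ` (`forall_smul_mem_iff_of_mul_self_eq_one`,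
`dichotomy_of_forall_smul_mem_iff`), an automorphism with `a ↦ b` preserves `Θ 0` and complements `Ψ`, so §1 gives HC on
all products of the reference pair, and `hodgeConjectureFor_cmProdAV_of_pair` concludes.
[cite: Gordon1999HodgeAVSurvey, §3 Theorem (Imai) and 10.10] -/
theorem hodgeConjectureFor_cmProdAV_of_isGalois_of_not_isCyclic [IsGalois ℚ K] (h₃ : CMAbelianVarietyRealised)
    (h4 : Module.finrank ℚ K = 4) (hK : ¬IsCyclic (K ≃ₐ[ℚ] K)) (n : ℕ) (Θ : Fin (n + 1) → CMType K) :
    HodgeConjectureFor (cmProdAV K h₃ n Θ).dim (cmProdAV K h₃ n Θ).X := by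
  classical
  haveI := isPretransitive_ringEquiv_complex (K := K)
  obtain ⟨a, b, hba, hba', hΦ⟩ := exists_mem_mem_ne h4 (Θ 0)
  obtain ⟨g, hbg⟩ := exists_eq_comp_algEquiv a b
  have hg2 : g * g = 1 := mul_self_eq_one_of_not_isCyclic h4 hK g
  have hcg : (conjGal : K ≃ₐ[ℚ] K) * g = g * conjGal := (commute_conjGal g).eq
  have hgc2 : g * conjGal * (g * conjGal) = 1 := by
    rw [mul_assoc, ← mul_assoc conjGal, hcg, mul_assoc, conjGal_mul_conjGal, mul_one, hg2]
  have hbc : conjugate b = a.comp (g * conjGal).toRingEquiv.toRingHom := by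
    rw [conjugate_eq_comp_conjGal b, hbg, comp_algEquiv_comp]
  -- the dichotomy for the reference pair `(Θ 0, Ψ)`, `Ψ = {a, b̄}`
  have hΨ := mem_flip_iff_of_pair h4 hba hba' hΦ
  have hab' : conjugate b ≠ a := fun h => hba' (by rw [← h, involutive_conjugate K b])
  have hcc : conjugate b ≠ conjugate a := fun h => hba ((involutive_conjugate K).injective h)
  have hΦ' : ∀ s, s ∈ (Θ 0).1 ↔ s = a ∨ s = a.comp g.toRingEquiv.toRingHom := by rw [← hbg]; exact hΦ
  have hΨ' : ∀ s, s ∈ (CMTypeOps.flip b (Θ 0)).1 ↔ s = a ∨ s = a.comp (g * conjGal).toRingEquiv.toRingHom := by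
    rw [← hbc]; exact hΨ
  have hWΦ := dichotomy_of_forall_smul_mem_iff h4 hba hba' hΦ fun τ => by
    rw [hbg]; exact forall_smul_mem_iff_of_mul_self_eq_one hg2 hΦ' τ
  have hWΨ := dichotomy_of_forall_smul_mem_iff h4 hab' hcc hΨ fun τ => by
    rw [hbc]; exact forall_smul_mem_iff_of_mul_self_eq_one hgc2 hΨ' τ
  have hW : ∀ (i : Fin 2) (τ : ℂ ≃+* ℂ),
      (∀ s : K →+* ℂ, τ • s ∈ (![Θ 0, CMTypeOps.flip b (Θ 0)] i).1 ↔ s ∈ (![Θ 0, CMTypeOps.flip b (Θ 0)] i).1) ∨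
      (∀ s : K →+* ℂ, τ • s ∈ (![Θ 0, CMTypeOps.flip b (Θ 0)] i).1 ↔ s ∉ (![Θ 0, CMTypeOps.flip b (Θ 0)] i).1) := by
    rw [Fin.forall_fin_two]
    exact ⟨hWΦ, hWΨ⟩
  -- `τ₀ : a ↦ b` preserves `Θ 0` and complements `Ψ`
  obtain ⟨τ₀, hτ₀⟩ := MulAction.exists_smul_eq (ℂ ≃+* ℂ) a b
  have hb0 : b ∈ (Θ 0).1 := (hΦ b).2 (Or.inr rfl)
  have hbΨ : b ∉ (CMTypeOps.flip b (Θ 0)).1 := fun h => by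
    rcases (hΨ b).1 h with h' | h'
    exacts [hba h', (conjugate_ne b).symm h']
  have h0 : ∀ s : K →+* ℂ, τ₀ • s ∈ (Θ 0).1 ↔ s ∈ (Θ 0).1 := by
    rcases hWΦ τ₀ with h | h
    · exact h
    · exact absurd ((hΦ a).2 (Or.inl rfl)) ((h a).1 (by rw [hτ₀]; exact hb0))
  have h1 : ∀ s : K →+* ℂ, τ₀ • s ∈ (CMTypeOps.flip b (Θ 0)).1 ↔ s ∉ (CMTypeOps.flip b (Θ 0)).1 := by
    rcases hWΨ τ₀ with h | h
    · exact absurd ((h a).2 ((hΨ a).2 (Or.inl rfl))) (by rw [hτ₀]; exact hbΨ)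
    · exact h
  refine hodgeConjectureFor_cmProdAV_of_pair h₃ h4 Θ hba hba' hΦ fun c => ?_
  exact hodgeConjectureFor_prod_of_dichotomy (F := ![Θ 0, CMTypeOps.flip b (Θ 0)])
    (A := fun i => (cmRealisation h₃ (cmCode K (![Θ 0, CMTypeOps.flip b (Θ 0)] i))).AV) c hW h0 h1 fun i =>
      isCMTypeRealisation_cmCode K h₃ (![Θ 0, CMTypeOps.flip b (Θ 0)] i)

/-! ## §3 The quartic slice of `HC_CM`, every quartic CM field, no hypothesis -/

/-- **HC for every `∏_j A_{(K,Θ_j)}` over EVERY quartic CM field `K`**, every finite family of CM types, every realisation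
record, NO hypothesis (non-Galois: `hodgeConjectureFor_cmProdAV_of_not_isGalois`; cyclic: `…_of_isGalois_of_isCyclic`;
biquadratic: `…_of_isGalois_of_not_isCyclic`). [cite: MoonenZarhin1999LowDim, section "Hodge groups of simple abelian surfaces of CM-type"]
[cite: Gordon1999HodgeAVSurvey, §3 Theorem, 7.5 and 10.10] -/
theorem hodgeConjectureFor_cmProdAV_quartic (h₃ : CMAbelianVarietyRealised) (h4 : Module.finrank ℚ K = 4) (n : ℕ)
    (Θ : Fin (n + 1) → CMType K) : HodgeConjectureFor (cmProdAV K h₃ n Θ).dim (cmProdAV K h₃ n Θ).X := by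
  by_cases hG : IsGalois ℚ K
  · by_cases hc : IsCyclic (K ≃ₐ[ℚ] K)
    · exact hodgeConjectureFor_cmProdAV_of_isGalois_of_isCyclic h₃ h4 hc n Θ
    · exact hodgeConjectureFor_cmProdAV_of_isGalois_of_not_isCyclic h₃ h4 hc n Θ
  · exact hodgeConjectureFor_cmProdAV_of_not_isGalois h₃ h4 hG n Θ

/-- **Everything dominated by some `∏_j A_{(K,Θ_j)}`, `K` any quartic CM field, satisfies HC** (isogeny factors, powers,
products, quotients). [cite: MumfordAV1970, §19] [cite: Gordon1999HodgeAVSurvey, 7.5 and 10.10] -/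
theorem hodgeConjectureFor_of_avDominatedBy_cmProdAV_quartic (h₃ : CMAbelianVarietyRealised)
    (h4 : Module.finrank ℚ K = 4) {A : AbelianVariety ℂ} {n : ℕ} {Θ : Fin (n + 1) → CMType K}
    (hA : AVDominatedBy A (cmProdAV K h₃ n Θ)) : HodgeConjectureFor A.dim A.X :=
  hodgeConjectureFor_of_avDominatedBy (hodgeConjectureFor_cmProdAV_quartic h₃ h4 n Θ) hA

/-- **THE QUARTIC SLICE OF `HC_CM`.**  Every complex abelian variety OF CM TYPE all of whose simple abelian subvarieties
have `End⁰ →+* K`, `K` ANY quartic CM field — equivalently: every abelian variety isogenous to a product of CM abelian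
surfaces and CM elliptic curves with complex multiplication inside one quartic CM field — satisfies the Hodge
conjecture.  UNCONDITIONAL: no named fact is displayed (`Milne1999.IsOfCMType A` is the hypothesis of
`Theses.RankFourFaces.CMAbelianHodge`; dimension `0` by the tree's HC in dimension `≤ 3`, positive dimension by seat
b30's record-free domination `CyclicSextic.exists_avDominatedBy_cmProdAV_of_isOfCMType_of_endAlgebra`).
[cite: MoonenZarhin1999LowDim, section "Hodge groups of simple abelian surfaces of CM-type"]
[cite: Gordon1999HodgeAVSurvey, §3 Theorem, 7.5 and 10.10] [cite: Shimura1998, §5.1, §6.2 Theorem 3, §7.1 Proposition 7] -/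
theorem hodgeConjectureFor_of_isOfCMType_of_endAlgebra_quartic (h4 : Module.finrank ℚ K = 4) {A : AbelianVariety ℂ}
    (hCM : IsOfCMType A)
    (hend : ∀ (B : AbelianVariety ℂ) (f : B ⟶ A), IsClosedImmersion (AbelianVariety.Hom.toSchemeHom f) →
      AbelianVariety.IsSimple B → 0 < B.dim → Nonempty (B.endAlgebra →+* K)) :
    HodgeConjectureFor A.dim A.X := by
  rcases Nat.eq_zero_or_pos A.dim with hA0 | hA0
  · exact hodgeConjectureFor_of_dim_le_three_holds (by omega) (AbelianVariety.isSmoothProjective_holds (A := A))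
  · obtain ⟨n, Θ, hdom⟩ := exists_avDominatedBy_cmProdAV_of_isOfCMType_of_endAlgebra hA0 hCM hend
    exact hodgeConjectureFor_of_avDominatedBy_cmProdAV_quartic cmAbelianVarietyRealised_holds h4 hdom

/-- **Everything dominated by such an `A` satisfies HC.** [cite: MumfordAV1970, §19] -/
theorem hodgeConjectureFor_of_avDominatedBy_isOfCMType_quartic (h4 : Module.finrank ℚ K = 4) {A C : AbelianVariety ℂ}
    (hA0 : 0 < A.dim) (hCM : IsOfCMType A)
    (hend : ∀ (B : AbelianVariety ℂ) (f : B ⟶ A), IsClosedImmersion (AbelianVariety.Hom.toSchemeHom f) →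
      AbelianVariety.IsSimple B → 0 < B.dim → Nonempty (B.endAlgebra →+* K))
    (hC : AVDominatedBy C A) : HodgeConjectureFor C.dim C.X := by
  obtain ⟨n, Θ, hdom⟩ := exists_avDominatedBy_cmProdAV_of_isOfCMType_of_endAlgebra hA0 hCM hend
  exact hodgeConjectureFor_of_avDominatedBy_cmProdAV_quartic cmAbelianVarietyRealised_holds h4 (hC.trans hdom)

/-- **`CMAbelianHodge` (= `HC_CM`) restricted to ANY quartic CM field, binders VERBATIM, no further hypothesis**: with
`IsSmoothProjective A.dim A.X` and `∃ S : Subalgebra ℚ A.endAlgebra, IsReduced S ∧ S commutative ∧ finrank ℚ S = 2 · dim A`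
written exactly as in `Theses.RankFourFaces.CMAbelianHodge`, plus «every simple abelian subvariety of positive dimension
has `End⁰ →+* K`» (`[K:ℚ] = 4`), the conclusion `HodgeConjectureFor A.dim A.X` holds.
[cite: MoonenZarhin1999LowDim, section "Hodge groups of simple abelian surfaces of CM-type"]
[cite: Gordon1999HodgeAVSurvey, §3 Theorem, 7.5 and 10.10] -/
theorem cmAbelianHodge_slice_quartic (h4 : Module.finrank ℚ K = 4) :
    ∀ A : AbelianVariety ℂ, IsSmoothProjective A.dim A.X →
      (∃ S : Subalgebra ℚ A.endAlgebra,
        IsReduced ↥S ∧ (∀ x ∈ S, ∀ y ∈ S, x * y = y * x) ∧ Module.finrank ℚ ↥S = 2 * A.dim) →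
      (∀ (B : AbelianVariety ℂ) (f : B ⟶ A), IsClosedImmersion (AbelianVariety.Hom.toSchemeHom f) →
        AbelianVariety.IsSimple B → 0 < B.dim → Nonempty (B.endAlgebra →+* K)) →
      HodgeConjectureFor A.dim A.X :=
  fun _ _ hCM hend => hodgeConjectureFor_of_isOfCMType_of_endAlgebra_quartic h4 hCM hend

end Summit.HodgeConjecture.CorCM.QuarticCM

end
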